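import Summits.CriticalPhenomena.PercolationContinuityZ3.Theorems.PercNearOneGluingNoHeavyLowerTailSunflowerMultiPetalKempeMarkedCharging
import HarnessLib
import HarnessLib.Audit

/-!
# `NoHeavyLowerTail` (crux stmt-CriticalPhenomena-4575), marked-multigraph layer: CONTRACTION BOOKKEEPING — `T` of the contracted graph
# `K.peelContract y S u` is `3^{|S|} · allZeroSum`

Support file (seat `prim-l12-p2` gen 47; `--supports stmt-CriticalPhenomena-4575`; continuation of `…KempeMarkedCells` (p595450: `allZeroSum`) and `…KempeMarkedCharging` (p596133: `cntM_isolate_update`)).  No `sorry`;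
nothing is asserted about the crux.  Memo: run/shared/lean/prim/prim-l12/prim-l12-p2/FINDING-g47-NEIGHBOURHOOD-CONTRACTION-STEP.md §6 (iii).

* `addAtU` (add edge weights and marks at the terminal `u`), `isolate_addAtU`, `linkM_addAtU`, **`cntM_addAtU`**;
* `contractOne s u` = isolate `s` and move its edges, marks and the `s–u` edge (as marks) to `u`; **`ctypeM_contractOne`**: its type at `ρ` (with `ρ u = 0`)
  is the type of `K` at `ρ[s ↦ 0]`;
* `ext'`, `peelContract_empty` (`= isolate y`), **`peelContract_insert`** (`= contractOne s` of the smaller contraction);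
* `sum_terminal_eq_sum_extCol`, `update_extCol`, **`sum_update_eq_three_mul`** (three-to-one counting);
* **`sum_peelContract_eq`** (induction on `S`, generalised over a pinned set `T`) and **`TfunM_peelContract`:
  `TfunM (K.peelContract y S u) u v = 3 ^ |S| * allZeroSum K y S u v`**.
With `sum_resCell_eq` (p595450) and `sum_resCell_nonneg` (…KempeMarkedHeart) this yields THEOREM L1 as `TfunM_step` (next file).
-/

namespace Summit.CriticalPhenomena.PercolationContinuityZ3.Theorems.SunflowerPartition.Kempe

open Finset

namespace MGraph

variable {V : Type*} [Fintype V] [LinearOrder V] (K : MGraph V)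

/-! ## Contraction bookkeeping: adding weights at the terminal, single-vertex contraction -/

section Contract

/-- Add edge weights `δ` (with `δ u = 0`) at the vertex `u` and `δm` marks at `u`. [this work] -/
def addAtU (u : V) (δ : V → ℕ) (hδ : δ u = 0) (δm : ℕ) : MGraph V where
  mul a b := K.mul a b + (if a = u then δ b else 0) + (if b = u then δ a else 0)
  mark a := K.mark a + (if a = u then δm else 0)
  symm a b := by rw [K.symm a b]; ring
  loopless a := by
    by_cases ha : a = u
    · subst ha; simp [K.loopless, hδ]
    · simp [ha, K.loopless]

omit [Fintype V] in
/-- Away from `u`, `addAtU` changes nothing: the two graphs have the same `isolate u`. [this work] -/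
theorem isolate_addAtU (u : V) (δ : V → ℕ) (hδ : δ u = 0) (δm : ℕ) : (K.addAtU u δ hδ δm).isolate u = K.isolate u := by
  unfold addAtU isolate
  congr 1
  · funext a b
    by_cases h : a = u ∨ b = u
    · simp [h]
    · push Not at h; simp [h.1, h.2]
  · funext a
    by_cases h : a = u
    · simp [h]
    · simp [h]

/-- The link of `u` in `addAtU` gains `Σ_w [σ w = c] δ w`. [this work] -/
theorem linkM_addAtU (u : V) (δ : V → ℕ) (hδ : δ u = 0) (δm : ℕ) (σ : V → Fin 3) (c : Fin 3) :
    (K.addAtU u δ hδ δm).linkM u σ c = K.linkM u σ c + ∑ w, (if σ w = c then δ w else 0) := by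
  unfold linkM addAtU
  rw [← sum_add_distrib]
  refine sum_congr rfl fun w _ => ?_
  by_cases hw : w = u
  · subst hw; simp [K.loopless, hδ]
  · by_cases hc : σ w = c
    · simp [hc, hw]
    · simp [hc]

/-- **Member counts of `addAtU`**: `#_c(K + weights at u) = #_c(K) + [σ u = c]·(Σ_w [σ w = c] δ w + δm)`. [this work] -/
theorem cntM_addAtU (u : V) (δ : V → ℕ) (hδ : δ u = 0) (δm : ℕ) (σ : V → Fin 3) (c : Fin 3) :
    (K.addAtU u δ hδ δm).cntM σ c = K.cntM σ c + (if σ u = c then (∑ w, (if σ w = c then δ w else 0)) + δm else 0) := by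
  rw [(K.addAtU u δ hδ δm).cntM_eq_isolate_add u σ c, K.cntM_eq_isolate_add u σ c, isolate_addAtU, linkM_addAtU]
  unfold addAtU
  simp only [if_true]
  by_cases h : σ u = c
  · simp only [if_pos h]; ring
  · simp only [if_neg h]

/-- SINGLE-VERTEX CONTRACTION of `s` into `u`: isolate `s` and move its edges, marks and its `s–u` edge (as marks) to `u`. [this work] -/
def contractOne (s u : V) : MGraph V :=
  (K.isolate s).addAtU u (fun w => if w = s ∨ w = u then 0 else K.mul s w) (by simp) (K.mark s + K.mul s u)


omit [Fintype V] [LinearOrder V] in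
/-- Extensionality for marked multigraphs. [this work] -/
theorem ext' {K L : MGraph V} (hmul : ∀ a b, K.mul a b = L.mul a b) (hmark : ∀ a, K.mark a = L.mark a) : K = L := by
  cases K; cases L
  simp only [MGraph.mk.injEq]
  exact ⟨funext fun a => funext fun b => hmul a b, funext hmark⟩

/-- **Type of a single-vertex contraction**: contracting `s` into the terminal `u` gives the type of `K` at the colouring with `s` recoloured `0`
(the colour of `u`). [this work] -/
theorem ctypeM_contractOne (s u : V) (hsu : s ≠ u) (ρ : V → Fin 3) (hu : ρ u = 0) :
    (K.contractOne s u).ctypeM ρ = K.ctypeM (Function.update ρ s 0) := by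
  have hc : ∀ c : Fin 3, (K.contractOne s u).cntM ρ c = K.cntM (Function.update ρ s 0) c := by
    intro c
    unfold contractOne
    rw [cntM_addAtU, K.cntM_eq_isolate_add s (Function.update ρ s 0) c, cntM_isolate_update, Function.update_self, hu]
    by_cases h0 : (0 : Fin 3) = c
    · rw [if_pos h0, if_pos h0]
      subst h0
      -- the weights moved to u account exactly for the link of s at the recoloured colouring
      have key : ∀ w : V, (if Function.update ρ s 0 w = 0 then K.mul s w else 0)
          = (if ρ w = 0 then (if w = s ∨ w = u then 0 else K.mul s w) else 0) + (if w = u then K.mul s u else 0) := by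
        intro w
        by_cases hws : w = s
        · subst hws; simp [K.loopless, hsu]
        · by_cases hwu : w = u
          · subst hwu; rw [Function.update_of_ne hws, hu]; simp [hws]
          · rw [Function.update_of_ne hws]; simp [hws, hwu]
      unfold linkM
      rw [sum_congr rfl (fun w _ => key w), sum_add_distrib, sum_ite_eq' univ u]
      simp only [mem_univ, if_true]
      ring
    · rw [if_neg h0, if_neg h0]
  unfold ctypeM
  rw [hc 0, hc 1, hc 2]

omit [Fintype V] in
/-- `peelContract y ∅ u = isolate y`. [this work] -/
theorem peelContract_empty (y u : V) : K.peelContract y ∅ u = K.isolate y := by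
  refine ext' (fun a b => ?_) (fun a => ?_)
  · unfold peelContract isolate
    simp only [notMem_empty, or_false, sum_empty, add_zero]
    by_cases h : a = y ∨ b = y
    · simp [h]
    · simp only [if_neg h]
      by_cases hau : a = u
      · subst hau
        by_cases hbu : b = a
        · subst hbu; simp [K.loopless]
        · simp [hbu]
      · by_cases hbu : b = u
        · subst hbu; simp [hau]
        · simp [hau, hbu]
  · unfold peelContract isolate
    simp only [notMem_empty, or_false, sum_empty, add_zero]
    by_cases h : a = y
    · simp [h]
    · simp only [if_neg h]
      by_cases hau : a = u
      · simp [hau]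
      · simp [hau]

omit [Fintype V] in
/-- `peelContract y (insert s S) u` is the single-vertex contraction of `s` applied to `peelContract y S u`. [this work] -/
theorem peelContract_insert (y u : V) (S : Finset V) (s : V) (hs : s ∉ S) (hsu : s ≠ u) (hsy : s ≠ y) (huS : u ∉ S) (huy : u ≠ y) :
    K.peelContract y (insert s S) u = (K.peelContract y S u).contractOne s u := by
  refine ext' (fun a b => ?_) (fun a => ?_)
  · unfold contractOne addAtU isolate peelContract
    simp only [mem_insert, sum_insert hs]
    by_cases hdead : a = y ∨ b = y ∨ (a = s ∨ a ∈ S) ∨ (b = s ∨ b ∈ S)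
    · rw [if_pos hdead]
      -- right-hand side vanishes too
      rcases hdead with h | h | (h | h) | (h | h)
      · simp [h, huy.symm]
      · simp [h, huy.symm]
      · simp [h, hsu]
      · have has : a ≠ s := fun e => hs (e ▸ h)
        have hau : a ≠ u := fun e => huS (e ▸ h)
        simp [h, has, hau]
      · simp [h, hsu]
      · have hbs : b ≠ s := fun e => hs (e ▸ h)
        have hbu : b ≠ u := fun e => huS (e ▸ h)
        simp [h, hbs, hbu]
    · rw [if_neg hdead]
      push Not at hdead
      obtain ⟨hay, hby, ⟨has, haS⟩, ⟨hbs, hbS⟩⟩ := hdead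
      have hdead' : ¬(a = y ∨ b = y ∨ a ∈ S ∨ b ∈ S) := by tauto
      by_cases hau : a = u
      · subst hau
        by_cases hbu : b = a
        · subst hbu; simp [K.loopless, has, hay, haS]
        · simp [hbu, has, hbs, hay, hby, haS, hbS, hsy, hs, hsu]; ring
      · by_cases hbu : b = u
        · subst hbu; simp [hau, has, hbs, hay, hby, haS, hbS, hsy, hs, K.symm s a, hsu]; ring
        · simp [hau, hbu, has, hbs, hay, hby, haS, hbS]
  · unfold contractOne addAtU isolate peelContract
    simp only [mem_insert, sum_insert hs]
    by_cases hdead : a = y ∨ (a = s ∨ a ∈ S)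
    · rw [if_pos hdead]
      rcases hdead with h | (h | h)
      · simp [h, huy.symm]
      · simp [h, hsu]
      · have has : a ≠ s := fun e => hs (e ▸ h)
        have hau : a ≠ u := fun e => huS (e ▸ h)
        simp [h, has, hau]
    · rw [if_neg hdead]
      push Not at hdead
      obtain ⟨hay, has, haS⟩ := hdead
      by_cases hau : a = u
      · subst hau
        have pair : ∀ x ∈ S, (if s < x then K.mul s x else 0) + (if x < s then K.mul x s else 0) = K.mul s x := by
          intro x hx
          have hxs : x ≠ s := fun e => hs (e ▸ hx)
          rcases lt_trichotomy s x with h | h | h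
          · simp [h, not_lt.2 h.le]
          · exact absurd h.symm hxs
          · simp [h, not_lt.2 h.le, K.symm x s]
        have hAB : (∑ x ∈ S, (if s < x then K.mul s x else 0)) + (∑ x ∈ S, (if x < s then K.mul x s else 0)) = ∑ x ∈ S, K.mul s x := by
          rw [← sum_add_distrib]; exact sum_congr rfl pair
        simp [hay, haS, has, has.symm, hsy, hs, sum_add_distrib]
        omega
      · simp [hau, hay, has, haS]


/-- Colourings with the terminal colours as pairs (colouring off `x`, colour of `x`), for any vertex `x ∉ {u,v}`. [this work] -/
theorem sum_terminal_eq_sum_extCol (x u v : V) (hux : u ≠ x) (hvx : v ≠ x) (f : (V → Fin 3) → ℤ) :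
    ∑ ρ ∈ univ.filter (fun ρ : V → Fin 3 => ρ u = 0 ∧ ρ v = 1), f ρ
      = ∑ τ ∈ univ.filter (fun τ : (({x}ᶜ : Set V)) → Fin 3 =>
          τ ⟨u, Set.mem_compl_singleton_iff.mpr hux⟩ = 0 ∧ τ ⟨v, Set.mem_compl_singleton_iff.mpr hvx⟩ = 1), ∑ c : Fin 3, f (extCol x τ c) := by
  set u' : ({x}ᶜ : Set V) := ⟨u, Set.mem_compl_singleton_iff.mpr hux⟩ with hu'
  set v' : ({x}ᶜ : Set V) := ⟨v, Set.mem_compl_singleton_iff.mpr hvx⟩ with hv'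
  rw [sum_filter, sum_filter]
  have hR : ∀ τ : (({x}ᶜ : Set V)) → Fin 3,
      (if τ u' = 0 ∧ τ v' = 1 then ∑ c : Fin 3, f (extCol x τ c) else 0) = ∑ c : Fin 3, (if τ u' = 0 ∧ τ v' = 1 then f (extCol x τ c) else 0) := by
    intro τ
    by_cases h : τ u' = 0 ∧ τ v' = 1
    · simp only [if_pos h]
    · simp only [if_neg h, sum_const_zero]
  rw [sum_congr rfl (fun τ _ => hR τ), ← Fintype.sum_prod_type']
  refine sum_nbij' (fun σ => (σ ∘ Subtype.val, σ x)) (fun p => extCol x p.1 p.2) (by simp) (by simp)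
    (fun σ _ => extCol_restrict x σ) (fun p _ => Prod.ext (extCol_comp_val x p.1 p.2) (extCol_self x p.1 p.2))
    (fun σ _ => ?_)
  dsimp only
  exact if_congr Iff.rfl (by rw [extCol_restrict]) rfl

omit [Fintype V] in
/-- Resetting the colour of `x` after extending by `c` is extending by the reset colour. [this work] -/
theorem update_extCol (x : V) (τ : (({x}ᶜ : Set V)) → Fin 3) (c d : Fin 3) : Function.update (extCol x τ c) x d = extCol x τ d := by
  funext w
  by_cases hw : w = x
  · subst hw; rw [Function.update_self, extCol_self]
  · rw [Function.update_of_ne hw, extCol_of_ne x τ c hw, extCol_of_ne x τ d hw]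

/-- **Three-to-one**: summing `G (ρ[x ↦ 0])` over the terminal-coloured colourings counts every colouring with `ρ x = 0` three times. [this work] -/
theorem sum_update_eq_three_mul (x u v : V) (hux : u ≠ x) (hvx : v ≠ x) (G : (V → Fin 3) → ℤ) :
    ∑ ρ ∈ univ.filter (fun ρ : V → Fin 3 => ρ u = 0 ∧ ρ v = 1), G (Function.update ρ x 0)
      = 3 * ∑ ρ ∈ univ.filter (fun ρ : V → Fin 3 => ρ u = 0 ∧ ρ v = 1), (if ρ x = 0 then G ρ else 0) := by
  rw [sum_terminal_eq_sum_extCol x u v hux hvx, sum_terminal_eq_sum_extCol x u v hux hvx, mul_sum]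
  refine sum_congr rfl fun τ _ => ?_
  rw [Fin.sum_univ_three, Fin.sum_univ_three, update_extCol, update_extCol, update_extCol, extCol_self, extCol_self, extCol_self]
  have h1 : ¬((1 : Fin 3) = 0) := by decide
  have h2 : ¬((2 : Fin 3) = 0) := by decide
  rw [if_pos rfl, if_neg h1, if_neg h2]
  ring

/-- **`T` of the contracted graph** (generalised over an extra pinned-to-`0` set `T` for the induction on `S`):
`Σ_ρ [ρ ≡ 0 on T]·fC(type_{peelContract y S u} ρ) = 3^{|S|} · Σ_ρ [ρ ≡ 0 on S ∪ T]·fC(type_{K.isolate y} ρ)`. [this work] -/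
theorem sum_peelContract_eq (y u : V) (S : Finset V) (huy : u ≠ y) (huS : u ∉ S) (hyS : y ∉ S) (v : V) (hvS : v ∉ S) :
    ∀ T : Finset V, Disjoint S T →
      ∑ ρ ∈ univ.filter (fun ρ : V → Fin 3 => ρ u = 0 ∧ ρ v = 1), (if ∀ t ∈ T, ρ t = 0 then fC ((K.peelContract y S u).ctypeM ρ) else 0)
        = 3 ^ S.card * ∑ ρ ∈ univ.filter (fun ρ : V → Fin 3 => ρ u = 0 ∧ ρ v = 1),
            (if ∀ t ∈ S ∪ T, ρ t = 0 then fC ((K.isolate y).ctypeM ρ) else 0) := by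
  induction S using Finset.induction_on with
  | empty =>
    intro T _
    rw [peelContract_empty, card_empty, pow_zero, one_mul]
    refine sum_congr rfl fun ρ _ => ?_
    simp
  | @insert s S hs ih =>
    intro T hT
    have hsu : s ≠ u := fun e => huS (e ▸ mem_insert_self s S)
    have hsy : s ≠ y := fun e => hyS (e ▸ mem_insert_self s S)
    have hsv : s ≠ v := fun e => hvS (e ▸ mem_insert_self s S)
    have huS' : u ∉ S := fun h => huS (mem_insert_of_mem h)
    have hyS' : y ∉ S := fun h => hyS (mem_insert_of_mem h)
    have hvS' : v ∉ S := fun h => hvS (mem_insert_of_mem h)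
    have hsT : s ∉ T := fun h => (disjoint_left.1 hT) (mem_insert_self s S) h
    have hST : Disjoint S (insert s T) := by
      rw [disjoint_insert_right]; exact ⟨hs, (disjoint_insert_left.1 hT).2⟩
    rw [K.peelContract_insert y u S s hs hsu hsy huS' huy, card_insert_of_notMem hs, pow_succ]
    -- contract s: types at ρ are types of the S-contraction at ρ[s ↦ 0]; the T-condition ignores s
    have step1 : ∀ ρ ∈ univ.filter (fun ρ : V → Fin 3 => ρ u = 0 ∧ ρ v = 1),
        (if ∀ t ∈ T, ρ t = 0 then fC (((K.peelContract y S u).contractOne s u).ctypeM ρ) else 0)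
          = (fun σ => if ∀ t ∈ T, σ t = 0 then fC ((K.peelContract y S u).ctypeM σ) else 0) (Function.update ρ s 0) := by
      intro ρ hρ
      have hu0 : ρ u = 0 := ((mem_filter.1 hρ).2).1
      have hiff : (∀ t ∈ T, ρ t = 0) ↔ (∀ t ∈ T, Function.update ρ s 0 t = 0) := by
        constructor
        · intro h t ht; rw [Function.update_of_ne (show t ≠ s from fun e => hsT (e ▸ ht))]; exact h t ht
        · intro h t ht; have := h t ht; rwa [Function.update_of_ne (show t ≠ s from fun e => hsT (e ▸ ht))] at this
      simp only
      rw [(K.peelContract y S u).ctypeM_contractOne s u hsu ρ hu0]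
      exact if_congr hiff rfl rfl
    rw [sum_congr rfl step1,
      sum_update_eq_three_mul s u v hsu.symm hsv.symm (fun σ => if ∀ t ∈ T, σ t = 0 then fC ((K.peelContract y S u).ctypeM σ) else 0)]
    have step2 : ∀ ρ ∈ univ.filter (fun ρ : V → Fin 3 => ρ u = 0 ∧ ρ v = 1),
        (if ρ s = 0 then (fun σ => if ∀ t ∈ T, σ t = 0 then fC ((K.peelContract y S u).ctypeM σ) else 0) ρ else 0)
          = (if ∀ t ∈ insert s T, ρ t = 0 then fC ((K.peelContract y S u).ctypeM ρ) else 0) := by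
      intro ρ _
      simp only
      by_cases h0 : ρ s = 0
      · rw [if_pos h0]
        refine if_congr ?_ rfl rfl
        constructor
        · intro h t ht
          exact (mem_insert.1 ht).elim (fun e => by rw [e, h0]) (fun ht' => h t ht')
        · intro h t ht; exact h t (mem_insert_of_mem ht)
      · rw [if_neg h0, if_neg (fun h => h0 (h s (mem_insert_self s T)))]
    rw [sum_congr rfl step2, ih huS' hyS' hvS' (insert s T) hST, ← mul_assoc, mul_comm (3 : ℤ) ((3 : ℤ) ^ S.card)]
    congr 1
    refine sum_congr rfl fun ρ _ => if_congr ?_ rfl rfl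
    constructor
    · intro h t ht
      rcases mem_union.1 ht with h1 | h1
      · rcases mem_insert.1 h1 with e | h2
        · exact h t (mem_union_right _ (by rw [e]; exact mem_insert_self s T))
        · exact h t (mem_union_left _ h2)
      · exact h t (mem_union_right _ (mem_insert_of_mem h1))
    · intro h t ht
      rcases mem_union.1 ht with h1 | h1
      · exact h t (mem_union_left _ (mem_insert_of_mem h1))
      · rcases mem_insert.1 h1 with e | h2
        · exact h t (mem_union_left _ (by rw [e]; exact mem_insert_self s S))
        · exact h t (mem_union_right _ h2)


/-- **`T` of the contracted graph is `3^{|S|}·allZeroSum`.** [this work] -/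
theorem TfunM_peelContract (y u v : V) (S : Finset V) (huy : u ≠ y) (huS : u ∉ S) (hyS : y ∉ S) (hvS : v ∉ S) :
    (K.peelContract y S u).TfunM u v = 3 ^ S.card * K.allZeroSum y S u v := by
  have h := K.sum_peelContract_eq y u S huy huS hyS v hvS ∅ (disjoint_empty_right S)
  unfold TfunM allZeroSum
  rw [union_empty] at h
  rw [← h]
  refine sum_congr rfl fun ρ _ => ?_
  rw [if_pos (fun t ht => absurd ht (notMem_empty t))]

end Contract

end MGraph

end Summit.CriticalPhenomena.PercolationContinuityZ3.Theorems.SunflowerPartition.Kempe
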